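import Literature.Analysis.FluidPDE.PassiveVectorWeakGradientHighModePairing
import Literature.Analysis.FunctionSpaces.TorusTrigPoly
import Literature.Analysis.FunctionSpaces.TorusCalculusProofs
import Literature.Analysis.FunctionSpaces.TorusEnstrophyOrthogonality
import HarnessLib

/-!
# The weak PIOLA identity: for `u ∈ L²(T^d; ℝ^d)` with an honest `L²` weak gradient and `∇·(G u) = 0` weakly (Piola frame `G`),
# `Σ_{c,m} G_{cm} (D c)_m = 0` a.e.

Analysis/FluidPDE proof file (everything proved; no definitions, no named facts, no `sorry`).

This discharges the hypothesis `hPiola` of `Torus.integral_gradForm_conj_weakGradient_ge` (`PassiveVectorWeakGradientGarding`) for the witnesses of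
the `ad-ideate` energy binders (`IsWeakTensorPassiveVectorDistortedOn`: the distorted constraint `∇·(G(t) w(t)) = 0` holds weakly for a.e. `t`, and the
binders supply `L²` weak gradients).  Armstrong–Vicol's Piola structure (divergence-free columns of `G = (∇X)⁻¹`, §4.1) makes
`∇·(G u) = Σ_m u_m ∇·G_{·m} + G:∇u = G:∇u`; here in the weak form.
* §1 `HasWeakPartialDeriv.coord` (components of a weak partial derivative), **`hasWeakPartialDeriv_smooth_mul_coord`** (product rule: the scalar
  `x ↦ g(x)·u_m(x)` has weak `c`-derivative `∂_c g·u_m + g·(D c)_m` for smooth `g`);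
* §2 **`ae_sum_frame_mul_weakGradient_eq_zero`** — the weak Piola identity (du Bois-Reymond `ae_eq_zero_of_forall_integral_mul_eq_zero`).

## Mathlib / tree search
Tree: `Torus.HasWeakPartialDeriv`, `Torus.IsWeaklyDivFree`, `Torus.IsDivFree`, `Torus.distort(_apply)`, `Torus.partialDeriv_mul`, `Torus.partialDeriv_apply_coord`,
`Torus.inner_gradient_eq_sum_mul_partialDeriv`, `Torus.ae_eq_zero_of_forall_integral_mul_eq_zero`, `Torus.IsSmooth.integrable_smul`. Mathlib:
`eval_integral_piLp`, `MemLp.of_le_mul`.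

## References
* S. Armstrong, V. Vicol, *Anomalous diffusion by fractal homogenization*, Ann. PDE (2025), §4.1 (Piola identity for `(∇X)⁻¹`). [`ArmstrongVicol2025`]
* L. C. Evans, *Partial Differential Equations*, 2nd ed. (2010), §5.2.1; §8.1.4.b. [`Evans2010`]
-/

open MeasureTheory Set Filter Topology UnitAddTorus
open scoped ENNReal NNReal InnerProductSpace

noncomputable section

namespace Literature.Analysis.FluidPDE

namespace Torus

open Literature.Analysis.FunctionSpaces Literature.Analysis.FunctionSpaces.Torus

variable {d : Type*} [Fintype d] [DecidableEq d]

/-! ## §1 Product rule for a smooth scalar multiplier -/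

/-- The components of a weak partial derivative of a vector field are weak partial derivatives of the components.
[cite: Evans2010, §5.2.1 (Definition of weak derivative)] -/
theorem HasWeakPartialDeriv.coord {c : d} {u Dc : UnitAddTorus d → EuclideanSpace ℝ d}
    (h : HasWeakPartialDeriv c u Dc) (hu : Integrable u volume) (hD : Integrable Dc volume) (m : d) :
    HasWeakPartialDeriv c (fun x => u x m) (fun x => Dc x m) := by
  intro φ hφ
  have h1 := h φ hφ
  have hL : ∀ i, Integrable (fun x => (FunctionSpaces.Torus.partialDeriv c φ x • u x) i) volume :=
    fun i => ((hφ.partialDeriv c).integrable_smul hu).eval_piLp i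
  have hR : ∀ i, Integrable (fun x => (φ x • Dc x) i) volume := fun i => (hφ.integrable_smul hD).eval_piLp i
  have h2 := congrArg (fun z : EuclideanSpace ℝ d => z m) h1
  simp only at h2
  rw [eval_integral_piLp hL m, WithLp.ofLp_neg, Pi.neg_apply, eval_integral_piLp hR m] at h2
  simpa only [PiLp.smul_apply, smul_eq_mul] using h2

/-- **Product rule**: for smooth `g` and `u ∈ L¹` with weak `c`-derivative `Dc ∈ L¹`, the scalar `g·u_m` has weak `c`-derivative `∂_c g·u_m + g·(Dc)_m`.
[cite: Evans2010, §5.2.1 (Definition of weak derivative)] -/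
theorem hasWeakPartialDeriv_smooth_mul_coord {c : d} {u Dc : UnitAddTorus d → EuclideanSpace ℝ d} {g : UnitAddTorus d → ℝ}
    (h : HasWeakPartialDeriv c u Dc) (hu : Integrable u volume) (hD : Integrable Dc volume) (hg : IsSmooth g) (m : d) :
    HasWeakPartialDeriv c (fun x => g x * u x m) (fun x => FunctionSpaces.Torus.partialDeriv c g x * u x m + g x * Dc x m) := by
  intro φ hφ
  beta_reduce
  have hm := HasWeakPartialDeriv.coord h hu hD m
  -- test the component identity with the smooth function `φ·g`
  have hφg : IsSmooth (fun x => φ x * g x) := hφ.mul hg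
  have key := hm (fun x => φ x * g x) hφg
  have hprod : ∀ x, FunctionSpaces.Torus.partialDeriv c (fun y => φ y * g y) x = φ x * FunctionSpaces.Torus.partialDeriv c g x + FunctionSpaces.Torus.partialDeriv c φ x * g x :=
    fun x => FunctionSpaces.Torus.partialDeriv_mul (hφ.isContDiff (by simp)) (hg.isContDiff (by simp)) c x
  simp only [hprod, smul_eq_mul] at key ⊢
  -- integrability of the pieces
  have hum : Integrable (fun x => u x m) volume := hu.eval_piLp m
  have hDm : Integrable (fun x => Dc x m) volume := hD.eval_piLp m
  have s1 : IsSmooth (fun x => φ x * FunctionSpaces.Torus.partialDeriv c g x) := hφ.mul (hg.partialDeriv c)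
  have s2 : IsSmooth (fun x => FunctionSpaces.Torus.partialDeriv c φ x * g x) := (hφ.partialDeriv c).mul hg
  have i1 : Integrable (fun x => φ x * FunctionSpaces.Torus.partialDeriv c g x * u x m) volume := by
    have := s1.integrable_smul hum; simpa [smul_eq_mul] using this
  have i2 : Integrable (fun x => FunctionSpaces.Torus.partialDeriv c φ x * g x * u x m) volume := by
    have := s2.integrable_smul hum; simpa [smul_eq_mul] using this
  have i3 : Integrable (fun x => φ x * g x * Dc x m) volume := by
    have := hφg.integrable_smul hDm; simpa [smul_eq_mul] using this
  have i4 : Integrable (fun x => φ x * (FunctionSpaces.Torus.partialDeriv c g x * u x m)) volume := i1.congr (Eventually.of_forall fun x => by ring)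
  have e1 : ∫ x, (φ x * FunctionSpaces.Torus.partialDeriv c g x + FunctionSpaces.Torus.partialDeriv c φ x * g x) * u x m = (∫ x, φ x * FunctionSpaces.Torus.partialDeriv c g x * u x m) + ∫ x, FunctionSpaces.Torus.partialDeriv c φ x * g x * u x m := by
    rw [← integral_add i1 i2]; exact integral_congr_ae (Eventually.of_forall fun x => by ring)
  rw [e1] at key
  have e2 : ∫ x, FunctionSpaces.Torus.partialDeriv c φ x * (g x * u x m) = ∫ x, FunctionSpaces.Torus.partialDeriv c φ x * g x * u x m :=
    integral_congr_ae (Eventually.of_forall fun x => by ring)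
  have e3 : ∫ x, φ x * (FunctionSpaces.Torus.partialDeriv c g x * u x m + g x * Dc x m) = (∫ x, φ x * FunctionSpaces.Torus.partialDeriv c g x * u x m) + ∫ x, φ x * g x * Dc x m := by
    rw [← integral_add i1 i3]; exact integral_congr_ae (Eventually.of_forall fun x => by ring)
  rw [e2, e3]
  linarith

/-! ## §2 The weak Piola identity -/

omit [Fintype d] [DecidableEq d] in
/-- A continuous real function on the torus is bounded. [folklore] -/
private theorem exists_bound_of_continuous₈ {f : UnitAddTorus d → ℝ} (hf : Continuous f) : ∃ C, ∀ x, |f x| ≤ C := by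
  obtain ⟨C, hC⟩ := isCompact_univ.exists_bound_of_continuousOn (hf.continuousOn (s := univ))
  exact ⟨C, fun x => by simpa [Real.norm_eq_abs] using hC x (mem_univ x)⟩

/-- **THE WEAK PIOLA IDENTITY.**  Let `G` have smooth entries and FunctionSpaces.Torus.divergence-free columns, `u ∈ L²` with an honest `L²` weak gradient
(`HasWeakPartialDeriv c u (D c)`, all `c`), and `∇·(G u) = 0` weakly.  Then `Σ_{c,m} G_{cm}(x) (D c x)_m = 0` for a.e. `x`.
[cite: ArmstrongVicol2025, §4.1 (s_{m−1}, T_{m−1}), PDF p. 34] [cite: Evans2010, §8.1.4.b] -/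
theorem ae_sum_frame_mul_weakGradient_eq_zero {G : UnitAddTorus d → Matrix d d ℝ} (hGs : ∀ c m, IsSmooth (fun y => G y c m))
    (hGp : ∀ m, FunctionSpaces.Torus.IsDivFree (fun y => (WithLp.toLp 2 fun c => G y c m : EuclideanSpace ℝ d)))
    {u : UnitAddTorus d → EuclideanSpace ℝ d} {D : d → UnitAddTorus d → EuclideanSpace ℝ d}
    (hu : MemLp u 2 volume) (hD : ∀ c, MemLp (D c) 2 volume) (hw : ∀ c, HasWeakPartialDeriv c u (D c))
    (hdiv : FunctionSpaces.Torus.IsWeaklyDivFree (distort G u)) :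
    ∀ᵐ x ∂volume, ∑ c, ∑ m, G x c m * (D c x) m = 0 := by
  have hui : Integrable u volume := hu.integrable one_le_two
  have hDi : ∀ c, Integrable (D c) volume := fun c => (hD c).integrable one_le_two
  -- the candidate is in `L²`
  have hL2 : MemLp (fun x => ∑ c, ∑ m, G x c m * (D c x) m) 2 volume := by
    refine memLp_finsetSum _ fun c _ => memLp_finsetSum _ fun m _ => ?_
    obtain ⟨C, hC⟩ := exists_bound_of_continuous₈ (hGs c m).continuous
    refine ((hD c).eval_piLp m).of_le_mul ((hGs c m).continuous.aestronglyMeasurable.mul ((hD c).eval_piLp m).1) (c := C) ?_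
    exact Eventually.of_forall fun x => by rw [Real.norm_eq_abs, Real.norm_eq_abs, abs_mul]; exact mul_le_mul_of_nonneg_right (hC x) (abs_nonneg _)
  refine FunctionSpaces.Torus.ae_eq_zero_of_forall_integral_mul_eq_zero hL2 fun θ hθ => ?_
  -- Piola columns: `Σ_c ∂_c G_cm = 0`
  have hcol : ∀ m x, ∑ c, FunctionSpaces.Torus.partialDeriv c (fun y => G y c m) x = 0 := by
    intro m x
    have h := hGp m x
    unfold FunctionSpaces.Torus.divergence at h
    rw [← h]
  -- the weak derivative identities tested with `θ`
  have hprod : ∀ c m, ∫ x, FunctionSpaces.Torus.partialDeriv c θ x * (G x c m * u x m) = -∫ x, θ x * (FunctionSpaces.Torus.partialDeriv c (fun y => G y c m) x * u x m + G x c m * D c x m) :=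
    fun c m => by
      have := hasWeakPartialDeriv_smooth_mul_coord (hw c) hui (hDi c) (hGs c m) m θ hθ
      simpa [smul_eq_mul] using this
  -- `∫⟪Gu, ∇θ⟫ = Σ_c Σ_m ∫ ∂_cθ G_cm u_m = 0`
  have hum : ∀ m, Integrable (fun x => u x m) volume := fun m => hui.eval_piLp m
  have hDm : ∀ c m, Integrable (fun x => D c x m) volume := fun c m => (hDi c).eval_piLp m
  have iA : ∀ c m, Integrable (fun x => FunctionSpaces.Torus.partialDeriv c θ x * (G x c m * u x m)) volume := fun c m => by
    have hs : IsSmooth (fun x => FunctionSpaces.Torus.partialDeriv c θ x * G x c m) := (hθ.partialDeriv c).mul (hGs c m)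
    have := hs.integrable_smul (hum m)
    exact this.congr (Eventually.of_forall fun x => by simp only [smul_eq_mul]; ring)
  have iB : ∀ c m, Integrable (fun x => θ x * (FunctionSpaces.Torus.partialDeriv c (fun y => G y c m) x * u x m)) volume := fun c m => by
    have hs : IsSmooth (fun x => θ x * FunctionSpaces.Torus.partialDeriv c (fun y => G y c m) x) := hθ.mul ((hGs c m).partialDeriv c)
    have := hs.integrable_smul (hum m)
    exact this.congr (Eventually.of_forall fun x => by simp only [smul_eq_mul]; ring)
  have iC : ∀ c m, Integrable (fun x => θ x * (G x c m * D c x m)) volume := fun c m => by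
    have hs : IsSmooth (fun x => θ x * G x c m) := hθ.mul (hGs c m)
    have := hs.integrable_smul (hDm c m)
    exact this.congr (Eventually.of_forall fun x => by simp only [smul_eq_mul]; ring)
  have h0 : ∑ c, ∑ m, ∫ x, FunctionSpaces.Torus.partialDeriv c θ x * (G x c m * u x m) = 0 := by
    have e2 : ∀ x, ⟪distort G u x, gradient θ x⟫_ℝ = ∑ c, ∑ m, FunctionSpaces.Torus.partialDeriv c θ x * (G x c m * u x m) := by
      intro x
      rw [FunctionSpaces.Torus.inner_gradient_eq_sum_mul_partialDeriv (hθ.isContDiff (by simp))]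
      refine Finset.sum_congr rfl fun c _ => ?_
      rw [distort_apply, Finset.sum_mul]
      exact Finset.sum_congr rfl fun m _ => by ring
    have e3 : ∫ x, ⟪distort G u x, gradient θ x⟫_ℝ = ∑ c, ∑ m, ∫ x, FunctionSpaces.Torus.partialDeriv c θ x * (G x c m * u x m) := by
      rw [show (fun x => ⟪distort G u x, gradient θ x⟫_ℝ) = fun x => ∑ c, ∑ m, FunctionSpaces.Torus.partialDeriv c θ x * (G x c m * u x m)
        from funext e2, integral_finsetSum _ fun c _ => integrable_finsetSum _ fun m _ => iA c m]
      exact Finset.sum_congr rfl fun c _ => integral_finsetSum _ fun m _ => iA c m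
    rw [← e3]; exact hdiv θ hθ
  -- assemble: `0 = −Σ_cΣ_m (∫θ(∂G u) + ∫θ G D)`, and the first part vanishes by Piola
  have hsum : ∑ c, ∑ m, ((∫ x, θ x * (FunctionSpaces.Torus.partialDeriv c (fun y => G y c m) x * u x m)) + ∫ x, θ x * (G x c m * D c x m)) = 0 := by
    have e : ∑ c, ∑ m, ∫ x, FunctionSpaces.Torus.partialDeriv c θ x * (G x c m * u x m)
        = -∑ c, ∑ m, ((∫ x, θ x * (FunctionSpaces.Torus.partialDeriv c (fun y => G y c m) x * u x m)) + ∫ x, θ x * (G x c m * D c x m)) := by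
      rw [← Finset.sum_neg_distrib]
      refine Finset.sum_congr rfl fun c _ => ?_
      rw [← Finset.sum_neg_distrib]
      refine Finset.sum_congr rfl fun m _ => ?_
      rw [hprod, ← integral_add (iB c m) (iC c m)]
      congr 1
      exact integral_congr_ae (Eventually.of_forall fun x => by ring)
    rw [e] at h0
    linarith
  have hP : ∑ c, ∑ m, ∫ x, θ x * (FunctionSpaces.Torus.partialDeriv c (fun y => G y c m) x * u x m) = 0 := by
    rw [Finset.sum_comm]
    refine Finset.sum_eq_zero fun m _ => ?_
    rw [← integral_finsetSum _ fun c _ => iB c m]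
    refine integral_eq_zero_of_ae (Eventually.of_forall fun x => ?_)
    have e : ∑ c, θ x * (FunctionSpaces.Torus.partialDeriv c (fun y => G y c m) x * u x m) = θ x * u x m * ∑ c, FunctionSpaces.Torus.partialDeriv c (fun y => G y c m) x := by
      rw [Finset.mul_sum]; exact Finset.sum_congr rfl fun c _ => by ring
    simp only [e, hcol m x, mul_zero, Pi.zero_apply]
  have hB : ∑ c, ∑ m, ∫ x, θ x * (G x c m * D c x m) = 0 := by
    have e : ∑ c, ∑ m, ((∫ x, θ x * (FunctionSpaces.Torus.partialDeriv c (fun y => G y c m) x * u x m)) + ∫ x, θ x * (G x c m * D c x m))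
        = (∑ c, ∑ m, ∫ x, θ x * (FunctionSpaces.Torus.partialDeriv c (fun y => G y c m) x * u x m)) + ∑ c, ∑ m, ∫ x, θ x * (G x c m * D c x m) := by
      rw [← Finset.sum_add_distrib]; exact Finset.sum_congr rfl fun c _ => Finset.sum_add_distrib
    rw [e, hP, zero_add] at hsum
    exact hsum
  -- `∫ θ·h = Σ_cΣ_m ∫ θ G D`
  have e1 : (fun x => θ x * ∑ c, ∑ m, G x c m * (D c x) m) = fun x => ∑ c, ∑ m, θ x * (G x c m * (D c x) m) := by
    funext x; rw [Finset.mul_sum]; exact Finset.sum_congr rfl fun c _ => by rw [Finset.mul_sum]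
  rw [e1, integral_finsetSum _ fun c _ => integrable_finsetSum _ fun m _ => iC c m]
  rw [show (∑ c, ∫ x, ∑ m, θ x * (G x c m * (D c x) m)) = ∑ c, ∑ m, ∫ x, θ x * (G x c m * D c x m) from
    Finset.sum_congr rfl fun c _ => integral_finsetSum _ fun m _ => iC c m]
  exact hB

end Torus

end Literature.Analysis.FluidPDE

end
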